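/-
Copyright (c) 2026 the pub-hodgecm-mathlib formalisation cell (harness21).  Prover seat hodgecm-mathlib-K2E3-p03 (g10) on the S4 valve (dealer K2E2-plan (g8), S4-R42∕R44∕R47∕R49∕R56:
road (J̃♭) FILE (TJ5) = the twisted tube Jacobian LETTER; (TJ5-abs)): THE HYPOTHESIS-FIRST ASSEMBLY of the localised letter (3′) from W-LOC, the window letters and the
Herbrand window identity.  Crux H413 `stmt-HodgeConjecture-24833`, lane `--supports … --as helper` (count-neutral).  THEOREMS ONLY (no `def`, no `instance`, no notation,
no named-fact hypothesis, no `sorry`).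
-/
import Summits.HodgeConjecture.HodgeConjecture.Theorems.R90S4TwistedTubeSweep          -- ★ p864668 (this seat): `image_twistedConj_mul_eq` (the sweep set identity)
import Summits.HodgeConjecture.HodgeConjecture.Theorems.R90S4TwistedTubeSweepMeasure   -- ★ p864813∕p864860 (this seat): `exists_sheet_and_subgroup_eq` (sheet formula + window mass, ONE κ)
import HarnessLib

/-!
# R90-TF · S4 (Ch. 13.1–2) · road (J̃♭) «TWISTED TUBE JACOBIAN», FILE (TJ5-abs): the assembly of the localised letter, hypothesis-first

Dealt by the S4 dealer K2E2-plan (g8) (S4-R42 02:31Z; plan of record S4-R44; letter localised in `T̃` S4-R49 (3′); assignments S4-R56).  THE ABSTRACT FRAME: `G` a second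
countable locally compact unimodular group (`G̃_v`), `ε : G →* G` (`ε_v`), `A ≤ G` a CLOSED ABELIAN `ε`-stable subgroup (`T̃ = Cent(γ₀)`), `P′ ≤ A` closed (`T′ = G̃_{δε} =
T̃^ε`), `φ : ↥A →* P` continuous onto a second countable locally compact group with `φ ∘ ε = φ` (the norm `N : T̃ → T`), Haar measures `ν` (`G`), `τA` (`A`), `τ′` (`P′`), `ρ`
(`ker φ`), `tP` (`P`), a basis `W j` of compact open `ε`-stable subgroups of `A` (the windows `T̃ ∩ c(Λ_j)`), a transversal `M₀ ⊆ G` (`c(pM Λ′ₖ)`) with its mass `m₀`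
(`= (ν∕τA)(π_A c(Λ′ₖ))`), the two families `Ψ(π_{P′} x, b) = Ψ♭(x, b) = x b ε(x)⁻¹`, a base point `b₁ ∈ A` with its W-LOC neighbourhood `U♭` and weights `D♭ = D_P ∘ φ`.
THE LETTERS CONSUMED (all hypotheses, each with its ★ or pending payer):
* `hwin₁ : ν(M₀·W_j) = μ₀(π_{P′}(M₀·W_j)) · τ′(P′ ∩ W_j)` — ★ (Q1) slice lemma + ★ C8b-window `slice_window` ((TJ5-win));
* `hwin₂ : ν(M₀·W_j) = m₀ · τA(W_j)` — ★ C8b-window `measure_window_eq` at `T := T̃` ((TJ5-win));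
* `hloc  : ν(Ψ♭(M₀ × V′)) = m₀ · ∫⁻_{V′} D♭ dτA` for Borel `V′ ⊆ U♭` — W-LOC (C131-p04 (g3) `twistedTubeJacobianLocal_of_chartData(_loss)`) on K2E4-p11 (g10)'s DATUM;
* `h♮    : ρ(c(W_j)) · τ′(P′ ∩ W_j) = ρ(ker φ ∩ W_j) · tP(φ(W_j))`, `c(w) = w ε(w)⁻¹` — the HERBRAND WINDOW identity (TJ6) (`h(⟨ε⟩, W_j) = 1` in Haar form).
THE THEOREM `twistedTubeJacobian_of_local`: **`∃ U′` open `∋ b₁`, `∃ A₀ ⊆ G ⧸ P′` Borel with `0 < μ₀(A₀) < ∞`, such that for every Borel SHEET `B ⊆ U′` (`φ` injective on `B`)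
`ν(Ψ(A₀ × B)) = μ₀(A₀) · ∫⁻_{φ(B)} D_P dtP`** (`μ₀ = ν∕τ′` on `G ⧸ P′`) — the (3′) letter at `b₁` once `B = (s·u)(V)`, `φ(B) = V` (★ `epsNorm_sheet`).
PROOF (numbers, not adjectives — six identities and one cancellation): with `A₀ = π_{P′}(M₀·W_j)`, `U′ = b₁ W_j` (`j ≥ j₀` and `b₁ W_j ⊆ U♭`):
(4′) `Ψ(A₀ × B) = Ψ♭(M₀ × B·c(W_j))` (★ `image_twistedConj_mul_eq`; `A` abelian); (5) `hloc` at `V′ = B·c(W_j) ⊆ U♭`; (6′) `∫⁻_{B·c(W_j)} D_P ∘ φ dτA = κ ρ(c(W_j))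
∫⁻_{φ(B)} D_P dtP` (★ sheet formula); (3′) `τA(W_j) = κ ρ(ker φ ∩ W_j) tP(φ(W_j))` (★ window mass, SAME κ); with `hwin₁`, `hwin₂`, `h♮`:
`μ₀(A₀) τ′(P′∩W_j) = ν(M₀W_j) = m₀ κ ρ(ker φ ∩ W_j) tP(φ W_j) = m₀ κ ρ(c W_j) τ′(P′∩W_j)`, cancel `τ′(P′ ∩ W_j) ∈ (0, ∞)`: `μ₀(A₀) = m₀ κ ρ(c(W_j))`, which is (5)∘(6′)'s constant.
HONEST LABEL: HC_CM is proved only modulo the 7 printed citations (2 remaining named inputs: hLiu418 = `stmt-HodgeConjecture-24832`, h413 = `stmt-HodgeConjecture-24833`)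
until rung 0 closes; (J̃♭) OPEN: this file pays the (3′) letter MODULO its four letters `hwin₁ hwin₂ hloc h♮` (REL ≠ ★ ≠ BUILT).

## References
* [Rogawski1990] J. Rogawski, *Automorphic Representations of Unitary Groups in Three Variables*, Ann. of Math. Stud. 123 (1990), §12.5 p. 186 (twisted Weyl integration), §3.11 pp. 34–35.
* [DeitmarEchterhoff2014] A. Deitmar, S. Echterhoff, *Principles of Harmonic Analysis*, 2nd ed. (2014), Thm. 1.5.3.
* [HarishChandra1970] Harish-Chandra (notes by G. van Dijk), *Harmonic Analysis on Reductive p-adic Groups*, LNM 162 (1970), Lemma 22.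
-/

set_option autoImplicit false
-- the mandated namespace repeats the single-problem summit's segment (`HodgeConjecture.HodgeConjecture`)
set_option linter.dupNamespace false

noncomputable section

open MeasureTheory MeasureTheory.Measure Set Filter Topology Function
open scoped ENNReal NNReal Pointwise
open Literature.MeasureTheory.Group

namespace Summit.HodgeConjecture.HodgeConjecture.R90.S4

section TJ5Core

variable {G : Type*} [Group G] (ε : G →* G) (A P' : Subgroup G) {P : Type*} [Group P] (φ : ↥A →* P)

/-! ## §1 Set algebra: the two families and the swept sheet -/

/-- `Ψ(π X × B) = F(X × B)` for the descended family `Ψ(π x, b) = x b ε(x)⁻¹` and `F(x, y) = x y ε(x)⁻¹` on `G × G`. [cite: Rogawski1990, §12.5 p. 186] -/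
theorem image_descFamily_eq (Ψ : (G ⧸ P') × ↥A → G) (hΨ : ∀ (x : G) (b : ↥A), Ψ (QuotientGroup.mk x, b) = x * b * (ε x)⁻¹) (X : Set G) (B : Set ↥A) :
    Ψ '' (((QuotientGroup.mk : G → G ⧸ P') '' X) ×ˢ B) = (fun p : G × G => p.1 * p.2 * (ε p.1)⁻¹) '' (X ×ˢ (Subtype.val '' B)) := by
  ext g
  simp only [mem_image, mem_prod, Prod.exists]
  constructor
  · rintro ⟨q, b, ⟨⟨x, hx, rfl⟩, hb⟩, rfl⟩
    exact ⟨x, b, ⟨hx, b, hb, rfl⟩, (hΨ x b).symm⟩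
  · rintro ⟨x, y, ⟨hx, b, hb, rfl⟩, rfl⟩
    exact ⟨QuotientGroup.mk x, b, ⟨⟨x, hx, rfl⟩, hb⟩, hΨ x b⟩

/-- `Ψ♭(X × S) = F(X × S)` for the family `Ψ♭(x, b) = x b ε(x)⁻¹` on `G × A`. [cite: Rogawski1990, §12.5 p. 186] -/
theorem image_family_eq (Ψf : G × ↥A → G) (hΨf : ∀ (x : G) (b : ↥A), Ψf (x, b) = x * b * (ε x)⁻¹) (X : Set G) (S : Set ↥A) :
    Ψf '' (X ×ˢ S) = (fun p : G × G => p.1 * p.2 * (ε p.1)⁻¹) '' (X ×ˢ (Subtype.val '' S)) := by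
  ext g
  simp only [mem_image, mem_prod, Prod.exists]
  constructor
  · rintro ⟨x, b, ⟨hx, hb⟩, rfl⟩
    exact ⟨x, b, ⟨hx, b, hb, rfl⟩, (hΨf x b).symm⟩
  · rintro ⟨x, y, ⟨hx, b, hb, rfl⟩, rfl⟩
    exact ⟨x, b, ⟨hx, hb⟩, hΨf x b⟩

/-- **The swept sheet**: on the abelian `ε`-stable `A` with `φ ∘ ε = φ`, the sweep `{w b ε(w)⁻¹ | w ∈ W, b ∈ B}` of a sheet `B ⊆ A` by a window `W ⊆ A` is the product
`B · c(W)` with `c(w) = w ε(w)⁻¹ ∈ ker φ`, read in `G`. [cite: Rogawski1990, §12.5 p. 186; §3.11 p. 34] -/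
theorem image_sweep_eq_coe_mul (hAc : ∀ x ∈ A, ∀ y ∈ A, x * y = y * x) (hεA : ∀ x ∈ A, ε x ∈ A) (hφε : ∀ w : ↥A, φ ⟨ε w, hεA w w.2⟩ = φ w)
    (W B : Set ↥A) :
    (fun q : G × G => q.1 * q.2 * (ε q.1)⁻¹) '' ((Subtype.val '' W) ×ˢ (Subtype.val '' B)) =
      Subtype.val '' (B * (Subtype.val '' ((Subtype.val : ↥φ.ker → ↥A) ⁻¹' ((fun w : ↥A => w * (⟨ε w, hεA w w.2⟩ : ↥A)⁻¹) '' W)))) := by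
  -- the coboundary `c(w) = w ε(w)⁻¹` lies in `ker φ`
  have hker : ∀ w : ↥A, w * (⟨ε w, hεA w w.2⟩ : ↥A)⁻¹ ∈ φ.ker := fun w => by
    rw [MonoidHom.mem_ker, map_mul, map_inv, hφε, mul_inv_cancel]
  ext g
  simp only [mem_image, mem_prod, Prod.exists]
  constructor
  · rintro ⟨x, y, ⟨⟨w, hw, rfl⟩, ⟨b, hb, rfl⟩⟩, rfl⟩
    refine ⟨b * (w * (⟨ε w, hεA w w.2⟩ : ↥A)⁻¹), Set.mul_mem_mul hb ⟨⟨_, hker w⟩, ⟨w, hw, rfl⟩, rfl⟩, ?_⟩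
    simp only [Subgroup.coe_mul, Subgroup.coe_inv]
    rw [hAc _ w.2 _ b.2, mul_assoc]
  · rintro ⟨a, ha, rfl⟩
    obtain ⟨b, hb, t, ⟨k, hk, rfl⟩, rfl⟩ := Set.mem_mul.1 ha
    obtain ⟨w, hw, hwk⟩ := hk
    refine ⟨w, b, ⟨⟨w, hw, rfl⟩, ⟨b, hb, rfl⟩⟩, ?_⟩
    rw [Subgroup.coe_mul, ← hwk, Subgroup.coe_mul, Subgroup.coe_inv, hAc _ w.2 _ b.2, mul_assoc]

/-! ## §2 The assembly -/

variable [TopologicalSpace G] [IsTopologicalGroup G] [LocallyCompactSpace G] [SecondCountableTopology G] [T2Space G] [MeasurableSpace G] [BorelSpace G]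
  [TopologicalSpace P] [IsTopologicalGroup P] [LocallyCompactSpace P] [SecondCountableTopology P] [T2Space P] [MeasurableSpace P] [BorelSpace P]

/-- **THE LOCALISED TWISTED TUBE-JACOBIAN LETTER FROM ITS FOUR LOCAL LETTERS** (`twistedTubeJacobian_of_local`, (TJ5-abs)).  In the frame of the module docstring, from
the window letters `hwin₁` (`P′`-slices), `hwin₂` (`A`-slices, the W-LOC transversal mass `m₀`), the local twisted tube identity `hloc` at `b₁` (W-LOC) and the Herbrand
window identity `h♮`, for the base point `b₁`: **there are an open `U′ ∋ b₁` in `A` and a Borel `A₀ ⊆ G ⧸ P′` with `0 < μ₀(A₀) < ∞` such that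
`ν(Ψ(A₀ × B)) = μ₀(A₀) · ∫⁻_{φ(B)} D_P dtP` for every Borel sheet `B ⊆ U′` on which `φ` is injective** (`μ₀ = quotientMeasure P′ τ′ _ ν`).  Choice: `U′ = b₁·W_j`,
`A₀ = π_{P′}(M₀·W_j)` for the first `j ≥ j₀` with `b₁ W_j ⊆ U♭`; then the swept sheet `B·c(W_j)` stays in `U♭`, and the six identities of the docstring close with the
cancellation of `τ′(P′ ∩ W_j) ∈ (0, ∞)` and of the sheet constant `κ`. [cite: Rogawski1990, §12.5 p. 186] [cite: HarishChandra1970, Lemma 22] [cite: DeitmarEchterhoff2014, Thm. 1.5.3] -/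
theorem twistedTubeJacobian_of_local [hA : IsClosed (A : Set G)] [hP' : IsClosed (P' : Set G)] (hP'A : P' ≤ A)
    (hAc : ∀ x ∈ A, ∀ y ∈ A, x * y = y * x) (hεA : ∀ x ∈ A, ε x ∈ A) (hεc : Continuous ε)
    (hφc : Continuous φ) (hφs : Function.Surjective φ) (hφε : ∀ w : ↥A, φ ⟨ε w, hεA w w.2⟩ = φ w)
    (ν : Measure G) [IsHaarMeasure ν] [ν.IsMulRightInvariant]
    (τA : Measure ↥A) [IsHaarMeasure τA] [τA.IsMulRightInvariant]
    (τ' : Measure ↥P') [IsHaarMeasure τ'] [τ'.IsInvInvariant] [SFinite τ']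
    (ρ : Measure ↥φ.ker) [IsHaarMeasure ρ] [ρ.IsInvInvariant] [SFinite ρ]
    (tP : Measure P) [IsHaarMeasure tP] [MeasurableSpace (G ⧸ P')] [BorelSpace (G ⧸ P')]
    (W : ℕ → Subgroup ↥A) (hWo : ∀ j, IsOpen (W j : Set ↥A)) (hWc : ∀ j, IsCompact (W j : Set ↥A)) (hWanti : Antitone W)
    (hWb : ∀ O ∈ 𝓝 (1 : ↥A), ∃ j, (W j : Set ↥A) ⊆ O) (hWε : ∀ (j : ℕ) (w : ↥A), w ∈ W j → (⟨ε w, hεA w w.2⟩ : ↥A) ∈ W j)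
    (M₀ : Set G) (m₀ : ℝ≥0∞) {j₀ : ℕ}
    (hA₀m : ∀ j, j₀ ≤ j → MeasurableSet ((QuotientGroup.mk : G → G ⧸ P') '' (M₀ * Subtype.val '' (W j : Set ↥A))))
    (hν : ∀ j, j₀ ≤ j → ν (M₀ * Subtype.val '' (W j : Set ↥A)) ≠ 0 ∧ ν (M₀ * Subtype.val '' (W j : Set ↥A)) ≠ ⊤)
    (hwin₁ : ∀ j, j₀ ≤ j → ν (M₀ * Subtype.val '' (W j : Set ↥A)) =
      quotientMeasure P' τ' hP' ν ((QuotientGroup.mk : G → G ⧸ P') '' (M₀ * Subtype.val '' (W j : Set ↥A))) *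
        τ' ((Subtype.val : ↥P' → G) ⁻¹' (Subtype.val '' (W j : Set ↥A))))
    (hwin₂ : ∀ j, j₀ ≤ j → ν (M₀ * Subtype.val '' (W j : Set ↥A)) = m₀ * τA (W j))
    (Ψf : G × ↥A → G) (hΨf : ∀ (x : G) (b : ↥A), Ψf (x, b) = x * b * (ε x)⁻¹)
    (Ψ : (G ⧸ P') × ↥A → G) (hΨ : ∀ (x : G) (b : ↥A), Ψ (QuotientGroup.mk x, b) = x * b * (ε x)⁻¹)
    {b₁ : ↥A} {Uloc : Set ↥A} (hUloc : Uloc ∈ 𝓝 b₁) (Dloc : ↥A → ℝ≥0) (DP : P → ℝ≥0) (hDP : Measurable DP) (hD : ∀ b ∈ Uloc, Dloc b = DP (φ b))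
    (hloc : ∀ V' : Set ↥A, MeasurableSet V' → V' ⊆ Uloc → ν (Ψf '' (M₀ ×ˢ V')) = m₀ * ∫⁻ b in V', (Dloc b : ℝ≥0∞) ∂τA)
    (hnat : ∀ j, j₀ ≤ j →
      ρ ((Subtype.val : ↥φ.ker → ↥A) ⁻¹' ((fun w : ↥A => w * (⟨ε w, hεA w w.2⟩ : ↥A)⁻¹) '' (W j : Set ↥A))) *
          τ' ((Subtype.val : ↥P' → G) ⁻¹' (Subtype.val '' (W j : Set ↥A))) =
        ρ ((Subtype.val : ↥φ.ker → ↥A) ⁻¹' (W j : Set ↥A)) * tP (φ '' (W j))) :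
    ∃ U' : Set ↥A, IsOpen U' ∧ b₁ ∈ U' ∧ ∃ A₀ : Set (G ⧸ P'), MeasurableSet A₀ ∧ quotientMeasure P' τ' hP' ν A₀ ≠ 0 ∧ quotientMeasure P' τ' hP' ν A₀ ≠ ⊤ ∧
      ∀ B : Set ↥A, MeasurableSet B → InjOn φ B → B ⊆ U' →
        ν (Ψ '' (A₀ ×ˢ B)) = quotientMeasure P' τ' hP' ν A₀ * ∫⁻ p in φ '' B, (DP p : ℝ≥0∞) ∂tP := by
  classical
  -- the sheet formula and the window mass with ONE constant `κ` (★ `exists_sheet_and_subgroup_eq`)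
  haveI hK : IsClosed ((φ.ker : Subgroup ↥A) : Set ↥A) := isClosed_ker φ hφc
  letI : MeasurableSpace (↥A ⧸ φ.ker) := borel _
  haveI : BorelSpace (↥A ⧸ φ.ker) := ⟨rfl⟩
  obtain ⟨κ, hκ0, hκt, hsheet, hwin⟩ := exists_sheet_and_subgroup_eq φ hφc hφs ρ τA tP
  -- the window index: `b₁ · W j ⊆ Uloc`
  have hpre : {w : ↥A | b₁ * w ∈ Uloc} ∈ 𝓝 (1 : ↥A) :=
    (continuous_const_mul b₁).continuousAt.preimage_mem_nhds (by rwa [mul_one])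
  obtain ⟨j₁, hj₁⟩ := hWb _ hpre
  set j := max j₀ j₁ with hjdef
  have hj : j₀ ≤ j := le_max_left _ _
  have hWj : (W j : Set ↥A) ⊆ {w : ↥A | b₁ * w ∈ Uloc} := fun w hw => hj₁ (hWanti (le_max_right j₀ j₁) hw)
  -- names
  set cA : ↥A → ↥A := fun w => w * (⟨ε w, hεA w w.2⟩ : ↥A)⁻¹ with hcA
  set T₀ : Set ↥φ.ker := (Subtype.val : ↥φ.ker → ↥A) ⁻¹' (cA '' (W j : Set ↥A)) with hT₀
  set S' : Set ↥P' := (Subtype.val : ↥P' → G) ⁻¹' (Subtype.val '' (W j : Set ↥A)) with hS'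
  set X : Set G := M₀ * Subtype.val '' (W j : Set ↥A) with hX
  set A₀ : Set (G ⧸ P') := (QuotientGroup.mk : G → G ⧸ P') '' X with hA₀
  set μ₀ := quotientMeasure P' τ' hP' ν with hμ₀
  -- `τ′(P′ ∩ W_j) ∈ (0, ∞)`
  have hS'eq : S' = (fun p : ↥P' => (⟨(p : G), hP'A p.2⟩ : ↥A)) ⁻¹' (W j : Set ↥A) := by
    ext p
    simp only [hS', mem_preimage, mem_image, SetLike.mem_coe]
    constructor
    · rintro ⟨w, hw, hwp⟩
      have : w = ⟨(p : G), hP'A p.2⟩ := Subtype.ext hwp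
      exact this ▸ hw
    · intro hp
      exact ⟨_, hp, rfl⟩
  have hS'o : IsOpen S' := by
    rw [hS'eq]
    exact (hWo j).preimage (continuous_subtype_val.subtype_mk _)
  have hS'0 : τ' S' ≠ 0 := hS'o.measure_ne_zero τ' ⟨1, by rw [hS'eq]; exact (W j).one_mem⟩
  have hS't : τ' S' ≠ ⊤ :=
    (hP'.isClosedEmbedding_subtypeVal.isCompact_preimage ((hWc j).image continuous_subtype_val)).measure_lt_top.ne
  -- `c(W_j) ⊆ ker φ` is compact, hence Borel
  have hcAc : Continuous cA := continuous_id.mul ((hεc.comp continuous_subtype_val).subtype_mk _).inv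
  have hT₀m : MeasurableSet T₀ := (((hWc j).image hcAc).isClosed.measurableSet).preimage measurable_subtype_coe
  -- `μ₀(A₀) ∈ (0, ∞)` and its value
  have hνX := hν j hj
  have e1 : ν X = μ₀ A₀ * τ' S' := hwin₁ j hj
  have hA₀0 : μ₀ A₀ ≠ 0 := fun h => hνX.1 (by rw [e1, h, zero_mul])
  have hA₀t : μ₀ A₀ ≠ ⊤ := fun h => hνX.2 (by rw [e1, h, ENNReal.top_mul hS'0])
  have e2 : ν X = m₀ * τA (W j) := hwin₂ j hj
  have e3 : τA (W j) = κ * ρ ((Subtype.val : ↥φ.ker → ↥A) ⁻¹' (W j : Set ↥A)) * tP (φ '' (W j)) := hwin (W j) (hWo j)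
  have e4 := hnat j hj
  have hval : μ₀ A₀ = m₀ * κ * ρ T₀ := by
    have h : μ₀ A₀ * τ' S' = m₀ * κ * ρ T₀ * τ' S' := by
      rw [← e1, e2, e3]
      calc m₀ * (κ * ρ ((Subtype.val : ↥φ.ker → ↥A) ⁻¹' (W j : Set ↥A)) * tP (φ '' (W j)))
          = m₀ * κ * (ρ ((Subtype.val : ↥φ.ker → ↥A) ⁻¹' (W j : Set ↥A)) * tP (φ '' (W j))) := by ring
        _ = m₀ * κ * (ρ T₀ * τ' S') := by rw [← e4]
        _ = m₀ * κ * ρ T₀ * τ' S' := by ring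
    exact (ENNReal.mul_left_inj hS'0 hS't).1 h
  -- the neighbourhood `U′ = b₁ · W_j`
  refine ⟨(fun b : ↥A => b₁⁻¹ * b) ⁻¹' (W j : Set ↥A), (hWo j).preimage (continuous_const_mul b₁⁻¹), by simp [(W j).one_mem], A₀, hA₀m j hj, hA₀0, hA₀t,
    fun B hBm hinj hBU => ?_⟩
  -- the swept sheet `B · c(W_j)` is Borel and stays inside `Uloc`
  set Sw : Set ↥A := B * Subtype.val '' T₀ with hSw
  have hSwm : MeasurableSet Sw := measurableSet_sheet_mul φ hφc hBm hinj hT₀m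
  have hSwU : Sw ⊆ Uloc := by
    intro a ha
    obtain ⟨b, hb, t, ⟨k, hk, rfl⟩, rfl⟩ := Set.mem_mul.1 ha
    obtain ⟨w, hw, hwk⟩ := hk
    have hb' : b₁⁻¹ * b ∈ W j := hBU hb
    have hmem : b₁⁻¹ * b * cA w ∈ W j := (W j).mul_mem hb' ((W j).mul_mem hw ((W j).inv_mem (hWε j w hw)))
    have h : b₁ * (b₁⁻¹ * b * cA w) ∈ Uloc := hWj hmem
    rwa [mul_assoc b₁⁻¹ b (cA w), mul_inv_cancel_left, hwk] at h
  -- (4′) the sweep set identity, (5) W-LOC on the swept sheet, (6′) the sheet formula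
  have h4 : Ψ '' (A₀ ×ˢ B) = Ψf '' (M₀ ×ˢ Sw) := by
    rw [hA₀, hX, image_descFamily_eq ε P' (A := A) Ψ hΨ, image_twistedConj_mul_eq ε M₀ (Subtype.val '' (W j : Set ↥A)) (Subtype.val '' B),
      image_sweep_eq_coe_mul ε A φ hAc hεA hφε, image_family_eq ε (A := A) Ψf hΨf]
  have h5 : ν (Ψf '' (M₀ ×ˢ Sw)) = m₀ * ∫⁻ b in Sw, (DP (φ b) : ℝ≥0∞) ∂τA := by
    rw [hloc Sw hSwm hSwU]
    congr 1
    exact setLIntegral_congr_fun hSwm fun b hb => by rw [hD b (hSwU hb)]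
  have h6 : ∫⁻ b in Sw, (DP (φ b) : ℝ≥0∞) ∂τA = κ * ρ T₀ * ∫⁻ p in φ '' B, (DP p : ℝ≥0∞) ∂tP := by
    rw [← lintegral_indicator hSwm]
    exact hsheet B hBm hinj T₀ hT₀m (fun p => (DP p : ℝ≥0∞)) hDP.coe_nnreal_ennreal
  rw [h4, h5, h6, hval]
  ring

end TJ5Core

end Summit.HodgeConjecture.HodgeConjecture.R90.S4

end
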